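import Summits.BirchSwinnertonDyer.Rank1Residual.ManinAdditive.TypeThreeSubgroupCharacter
import Summits.BirchSwinnertonDyer.BirchSwinnertonDyer.Theorems.ManinLocalTwoThreeTameThreeLocalLineLaws
import HarnessLib

/-!
# E-imc-76 `TameThreeIIIShallowIffLocalLine` and E-imc-77 `TameThreeIIICanonicalLineUnramified` HOLD (by name)

Cell `bsd-f2-manin`.  The leaf `TypeThreeSubgroupCharacter.lean` (third cluster, typer T-54c, p629830) NAMES imc g14's
rows E-imc-76/77 in the datum-free form of refuter-1 T-54a; bsd-line-manin23-p2 (g7) had already PROVED exactly these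
statements in `Theorems/ManinLocalTwoThreeTameThreeLocalLineLaws.lean` (p628327: `tameThreeIII_localLine_iff_shallow`,
`tameThreeIII_canonicalLine_unramified`; its import cone is free of route `Theses` files).  This file records the two
by-name closers — one-liners, the leaf's `DeepIII W` and `IsLocalThreeSubgroupX W x` being definitionally p2's unfolded
hypotheses — and the resulting unconditional forms of the leaf's consumer edges (deep III ⟹ no `G_{ℚ₃}`-stable line ⟹
`E[3] ⊗ ℚ₃` irreducible; a rational `3`-subgroup ⟹ shallow).  Nothing about BSD or Manin's conjecture is proved here;
C3 `ManinPrimeToThreeAtNine` remains open.  bears_on: stmt-BirchSwinnertonDyer-22968.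
-/

set_option autoImplicit false

noncomputable section

open Summit.BirchSwinnertonDyer.BirchSwinnertonDyer.Theorems.ManinLocalTwoThree

namespace Summit.BirchSwinnertonDyer.Rank1Residual.ManinAdditive.TameThreeCharacter

/-- **E-imc-76 holds**: on a global minimal model with `9 ∥ N`, `v₃ Δ_min = 3`, `E[3]` has a `G_{ℚ₃}`-stable line iff the
curve is shallow (p2's `tameThreeIII_localLine_iff_shallow`, p628327). -/
theorem TameThreeIIIShallowIffLocalLine_holds : TameThreeIIIShallowIffLocalLine :=
  fun W _ _ h9 h27 hΔ ↦ tameThreeIII_localLine_iff_shallow W h9 h27 hΔ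

/-- **E-imc-77 holds**: the canonical line of a type-III curve at `3` has an unramified character — `D₀ ≠ 0` with even
(indeed zero) `3`-adic valuation (p2's `tameThreeIII_canonicalLine_unramified`, p628327). -/
theorem TameThreeIIICanonicalLineUnramified_holds : TameThreeIIICanonicalLineUnramified :=
  fun W _ _ h9 h27 hΔ x hx ↦ tameThreeIII_canonicalLine_unramified W h9 h27 hΔ x hx

/-- Deep type III at `3` ⟹ NO `G_{ℚ₃}`-stable line of `E[3]`, unconditionally. -/
theorem noLocalThreeLineAtThree_of_deepIII' (W : WeierstrassCurve ℚ) [W.IsElliptic] [W.IsGloballyMinimal]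
    (h9 : 3 ^ 2 ∣ W.conductorNorm ℤ) (h27 : ¬ 3 ^ 3 ∣ W.conductorNorm ℤ)
    (hIII : padicValInt 3 W.minimalDiscriminantInt = 3) (hd : DeepIII W) : NoLocalThreeLineAtThree W :=
  noLocalThreeLineAtThree_of_deepIII TameThreeIIIShallowIffLocalLine_holds W h9 h27 hIII hd

/-- Deep type III at `3` ⟹ `E[3] ⊗ ℚ₃` is an irreducible Galois module, unconditionally (es E-es-20 / E-imc-78 input). -/
theorem hasIrreducibleModPGaloisRep_three_of_deepIII' (W : WeierstrassCurve ℚ) [W.IsElliptic] [W.IsGloballyMinimal]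
    (h9 : 3 ^ 2 ∣ W.conductorNorm ℤ) (h27 : ¬ 3 ^ 3 ∣ W.conductorNorm ℤ)
    (hIII : padicValInt 3 W.minimalDiscriminantInt = 3) (hd : DeepIII W) :
    (W.baseChange ℚ_[3]).HasIrreducibleModPGaloisRep 3 :=
  hasIrreducibleModPGaloisRep_three_of_deepIII TameThreeIIIShallowIffLocalLine_holds W h9 h27 hIII hd

/-- A shallow type-III curve at `3` has a `ℚ₃`-rational `3`-subgroup abscissa, unconditionally. -/
theorem exists_isLocalThreeSubgroupX_of_shallow' (W : WeierstrassCurve ℚ) [W.IsElliptic] [W.IsGloballyMinimal]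
    (h9 : 3 ^ 2 ∣ W.conductorNorm ℤ) (h27 : ¬ 3 ^ 3 ∣ W.conductorNorm ℤ)
    (hIII : padicValInt 3 W.minimalDiscriminantInt = 3) (hs : ¬ DeepIII W) : ∃ x : ℚ_[3], IsLocalThreeSubgroupX W x :=
  exists_isLocalThreeSubgroupX_of_shallow TameThreeIIIShallowIffLocalLine_holds W h9 h27 hIII hs

/-- A rational `3`-subgroup on a type-III curve at `3` forces SHALLOW, unconditionally. -/
theorem not_deepIII_of_isThreeSubgroupX' (W : WeierstrassCurve ℚ) [W.IsElliptic] [W.IsGloballyMinimal]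
    (h9 : 3 ^ 2 ∣ W.conductorNorm ℤ) (h27 : ¬ 3 ^ 3 ∣ W.conductorNorm ℤ)
    (hIII : padicValInt 3 W.minimalDiscriminantInt = 3) {x₀ : ℚ} (hx : IsThreeSubgroupX W x₀) : ¬ DeepIII W :=
  not_deepIII_of_isThreeSubgroupX TameThreeIIIShallowIffLocalLine_holds W h9 h27 hIII hx

end Summit.BirchSwinnertonDyer.Rank1Residual.ManinAdditive.TameThreeCharacter

end
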